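import Summits.CriticalPhenomena.PercolationContinuityZ3.Theorems.Transplant.SkelPhiParaBandChainS
import HarnessLib

/-!
# N1 (the `{±1}` node), LEVEL 1, (C) column file (C-N9w): THE SIGNED BANDS OF THE (C) CORRIDOR WITH A FREE STEERING WINDOW — the x-band record
# `xPrmWw n ℓ h R′ q N Wm Wp` and the y′-band record `yPrmXw n ℓ h v R′ q N Wm Wp`: p1's `xPrmW` / (C-N9)'s `yPrmX` with the transverse steering window
# `[−Wm, Wp]` a PARAMETER (admissible as soon as the landing pieces fit: `⌊nℓ/U⌋ + 1 ≤ Wm, Wp`, resp. `n + v ≤ Wm`, `n − v ≤ Wp`), so that the band's start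
# core `{|along| ≤ q, −Wm ≤ across ≤ Wp}` can hold the LAST CORE OF THE LOCALISATION ROUNDS, whose transverse half-width `W + (N+1)·e` exceeds the pieces
# (`LocPrm.Wk`; located 2026-08-21, lane INBOX (L1)): the join hypotheses `hjoin/hreg` of `corrRunSchedS` / `reachOblRHN_negSG₂b` become satisfiable.
# Graph side, verbatim from (C-N9) (`link_runX`, `landing_runX_W_signed`, `topPieceW_run_bounds`, `RunPrm.inRegion_of_link / inCore_succ_of_landing` are
# record-generic): **link ⊆ region** and **steered piece ⊆ next core** for both windowed bands in the one frame `runX φ c₀ n h 1`.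

builds on p205010 (kernel theorem, internal audit signed; external expert review pending) — nothing in this file uses p205010; nothing here is a
claim about the open node `SamePDropOfSkeletonNeg`.
Lane `prim-bschramm`, seat `prim-bschramm-p5` (gen 9; (C) lineage); helper file (`--supports stmt-CriticalPhenomena-4575`).
[cite: MartineauTassion2017, §3.2 Lemma 3.5, §4.3 Lemma 4.2] [cite: KozmaNitzan2024, §4 Lemma 11 (pp. 22–23), Lemma 12 (pp. 23–25)]
-/

noncomputable section

namespace Summit.CriticalPhenomena.PercolationContinuityZ3.Theorems.Transplant

namespace Skelφ

open Literature.Probability.Percolation Literature.Probability.LatticeModels SimpleGraph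
open Literature.Probability.Percolation.KozmaNitzan.Cells (oth)
open ChainPlanar ChainPara

variable {V : Type} {G : SimpleGraph V} {φ : V → Site 2}

/-- `oth 0 = 1` on `Fin 2`. [folklore] -/
private theorem oth_zero' : oth (0 : Fin 2) = 1 := by decide

/-- `oth 1 = 0` on `Fin 2`. [folklore] -/
private theorem oth_one' : oth (1 : Fin 2) = 0 := by decide

/-! ## §1 The windowed records -/

/-- **x-band parameters with a free steering window** `[−Wm, Wp]` (everything else as p1's `xPrmW`: stride exactly `n`, no drift, pieces `⌊nℓ/U⌋ + 1`,
slack `R′` both ways, link box `n × (⌊3nℓ/U⌋ + 1)`, start half-length `q`, steps `0..N`). [this work] -/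
def xPrmWw (n ℓ : ℕ) (h : ℤ) (R' q N Wm Wp : ℕ) : ChainPara.RunPrm where
  sLo := n
  sHi := n
  d := 0
  Pp := n * ℓ / shearUnit n h + 1
  Pm := n * ℓ / shearUnit n h + 1
  Wp := Wp
  Wm := Wm
  ea := R'
  eb := R'
  La := n
  Lb := 3 * (n * ℓ) / shearUnit n h + 1
  q := q
  N := N

/-- Admissibility of the windowed x-band: both pieces fit in the window. [folklore] -/
theorem xPrmWw_ok (n ℓ : ℕ) (h : ℤ) (R' q N : ℕ) {Wm Wp : ℕ} (hWm : n * ℓ / shearUnit n h + 1 ≤ Wm) (hWp : n * ℓ / shearUnit n h + 1 ≤ Wp) :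
    ChainPara.RunOK (xPrmWw n ℓ h R' q N Wm Wp) where
  hs0 := by simp [xPrmWw]
  hs := le_rfl
  hsL := by simp [xPrmWw]
  hd := by simp only [xPrmWw, abs_zero]; positivity
  hPm := hWm
  hPp := hWp

/-- `eb = ea` for the windowed x-band. [folklore] -/
theorem xPrmWw_eb (n ℓ : ℕ) (h : ℤ) (R' q N Wm Wp : ℕ) : (xPrmWw n ℓ h R' q N Wm Wp).eb = (xPrmWw n ℓ h R' q N Wm Wp).ea := rfl

/-- The windowed x-band's along slack is `R′`. [folklore] -/
theorem xPrmWw_ea (n ℓ : ℕ) (h : ℤ) (R' q N Wm Wp : ℕ) : (xPrmWw n ℓ h R' q N Wm Wp).ea = R' := rfl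

/-- **y′-band parameters with a free steering window** `[−Wm, Wp]` (everything else as (C-N9)'s `yPrmX`: floored along readings
`[⌊(nℓ−U+1)/U⌋ − 1, ⌊nℓ/U⌋ + 1]`, drift `v`, pieces `n ∓ v`, slack `R′`, link box `(⌊3nℓ/U⌋ + 1) × n`). [this work] -/
def yPrmXw (n ℓ : ℕ) (h v : ℤ) (R' q N Wm Wp : ℕ) : ChainPara.RunPrm where
  sLo := ((n : ℤ) * ℓ - (shearUnit n h : ℕ) + 1) / (shearUnit n h : ℕ) - 1
  sHi := (n : ℤ) * ℓ / (shearUnit n h : ℕ) + 1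
  d := v
  Pp := (n - v).toNat
  Pm := (n + v).toNat
  Wp := Wp
  Wm := Wm
  ea := R'
  eb := R'
  La := 3 * (n * ℓ) / shearUnit n h + 1
  Lb := n
  q := q
  N := N

/-- Admissibility of the windowed y′-band (`1 ≤ n`, `|v| ≤ n`, two layers, both drifted pieces inside the window). [folklore] -/
theorem yPrmXw_ok {n ℓ : ℕ} {h v : ℤ} (hn : 1 ≤ n) (hv : |v| ≤ n) (hlay : 2 * ((n + h.natAbs : ℕ) : ℤ) ≤ (n : ℤ) * ℓ + 1) (R' q N : ℕ) {Wm Wp : ℕ}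
    (hWm : (n + v).toNat ≤ Wm) (hWp : (n - v).toNat ≤ Wp) : ChainPara.RunOK (yPrmXw n ℓ h v R' q N Wm Wp) where
  hs0 := (yPrmX_ok hn hv hlay R' q N).hs0
  hs := (yPrmX_ok hn hv hlay R' q N).hs
  hsL := (yPrmX_ok hn hv hlay R' q N).hsL
  hd := (yPrmX_ok hn hv hlay R' q N).hd
  hPm := hWm
  hPp := hWp

/-- `eb = ea` for the windowed y′-band. [folklore] -/
theorem yPrmXw_eb (n ℓ : ℕ) (h v : ℤ) (R' q N Wm Wp : ℕ) : (yPrmXw n ℓ h v R' q N Wm Wp).eb = (yPrmXw n ℓ h v R' q N Wm Wp).ea := rfl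

/-- The windowed y′-band's along slack is `R′`. [folklore] -/
theorem yPrmXw_ea (n ℓ : ℕ) (h v : ℤ) (R' q N Wm Wp : ℕ) : (yPrmXw n ℓ h v R' q N Wm Wp).ea = R' := rfl

/-! ## §2 The windowed x-band in the run frame of sign `1` -/

section XBandW

variable {n ℓ : ℕ} (hn : 1 ≤ n) (c₀ : V) (h : ℤ) {σB : ℤ} (hσB : σB = 1 ∨ σB = -1) (R' q N : ℕ) {Wm Wp : ℕ}
  (hWm : n * ℓ / shearUnit n h + 1 ≤ Wm) (hWp : n * ℓ / shearUnit n h + 1 ≤ Wp)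
include hn

/-- **Link ⊆ region, signed x-band with a free window**: `runX t` in the `R′`-enlarged core `k` of `(xPrmW …).scheduleN 0 σB 0` and `w ∈ pgramPrism t n h (3ℓ) R` give
`runX w ∈ region k`. [cite: KozmaNitzan2024, §4 Lemma 11 (p. 22)] -/
theorem runX_mem_xbandWRegion_of_link {k : ℕ} {t w : V} {R : ℕ}
    (ht : runX φ c₀ n h 1 t ∈ Finset.Icc (((xPrmWw n ℓ h R' q N Wm Wp).scheduleN 0 hσB 0 (xPrmWw_ok n ℓ h R' q N hWm hWp) (xPrmWw_eb n ℓ h R' q N Wm Wp)).lo k -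
        ((((xPrmWw n ℓ h R' q N Wm Wp).scheduleN 0 hσB 0 (xPrmWw_ok n ℓ h R' q N hWm hWp) (xPrmWw_eb n ℓ h R' q N Wm Wp)).R' : ℕ) : Site 2))
      (((xPrmWw n ℓ h R' q N Wm Wp).scheduleN 0 hσB 0 (xPrmWw_ok n ℓ h R' q N hWm hWp) (xPrmWw_eb n ℓ h R' q N Wm Wp)).hi k +
        ((((xPrmWw n ℓ h R' q N Wm Wp).scheduleN 0 hσB 0 (xPrmWw_ok n ℓ h R' q N hWm hWp) (xPrmWw_eb n ℓ h R' q N Wm Wp)).R' : ℕ) : Site 2)))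
    (hw : w ∈ pgramPrism G φ t n h (3 * ℓ) R) :
    runX φ c₀ n h 1 w ∈ ((xPrmWw n ℓ h R' q N Wm Wp).scheduleN 0 hσB 0 (xPrmWw_ok n ℓ h R' q N hWm hWp) (xPrmWw_eb n ℓ h R' q N Wm Wp)).region k := by
  have ht' := (mem_runSched_enl_iff 0 hσB 0 (xPrmWw_ok n ℓ h R' q N hWm hWp) (xPrmWw_eb n ℓ h R' q N Wm Wp)).1 ht
  obtain ⟨h0, h1⟩ := link_runX hn c₀ h (Or.inl rfl) hw R' q N
  have hσ1 : |σB| = 1 := by rcases hσB with rfl | rfl <;> simp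
  rw [RunPrm.scheduleN_region, RunPrm.mem_pregion_iff hσB]
  simp only [Pi.zero_apply, sub_zero, oth_zero'] at ht' ⊢
  refine RunPrm.inRegion_of_link ht' ?_ ?_
  · rw [← mul_sub, abs_mul, hσ1, one_mul]; exact h0
  · rw [← mul_sub, abs_mul, hσ1, one_mul]; exact h1

/-- **Steered side half ⊆ next core, signed x-band with a free window**: every stride has physical sign `σB`; with `τₖ := steer k (σB·runX t 1)`, every
`w ∈ pgSideHalfW t n h ℓ R σB (σB·τₖ)` has `runX w ∈ core (k+1)`. [cite: MartineauTassion2017, §4.3 Lemma 4.2] [cite: KozmaNitzan2024, §4 Lemma 12] -/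
theorem runX_mem_xbandWCore_succ_of_piece [G.LocallyFinite] {k : ℕ} {t w : V} {R : ℕ}
    (ht : runX φ c₀ n h 1 t ∈ Finset.Icc (((xPrmWw n ℓ h R' q N Wm Wp).scheduleN 0 hσB 0 (xPrmWw_ok n ℓ h R' q N hWm hWp) (xPrmWw_eb n ℓ h R' q N Wm Wp)).lo k -
        ((((xPrmWw n ℓ h R' q N Wm Wp).scheduleN 0 hσB 0 (xPrmWw_ok n ℓ h R' q N hWm hWp) (xPrmWw_eb n ℓ h R' q N Wm Wp)).R' : ℕ) : Site 2))
      (((xPrmWw n ℓ h R' q N Wm Wp).scheduleN 0 hσB 0 (xPrmWw_ok n ℓ h R' q N hWm hWp) (xPrmWw_eb n ℓ h R' q N Wm Wp)).hi k +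
        ((((xPrmWw n ℓ h R' q N Wm Wp).scheduleN 0 hσB 0 (xPrmWw_ok n ℓ h R' q N hWm hWp) (xPrmWw_eb n ℓ h R' q N Wm Wp)).R' : ℕ) : Site 2)))
    (hw : w ∈ pgSideHalfW G φ t n h ℓ R σB (σB * (xPrmWw n ℓ h R' q N Wm Wp).steer k (σB * runX φ c₀ n h 1 t 1))) :
    runX φ c₀ n h 1 w ∈ ((xPrmWw n ℓ h R' q N Wm Wp).scheduleN 0 hσB 0 (xPrmWw_ok n ℓ h R' q N hWm hWp) (xPrmWw_eb n ℓ h R' q N Wm Wp)).core (k + 1) := by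
  set τ₀ := (xPrmWw n ℓ h R' q N Wm Wp).steer k (σB * runX φ c₀ n h 1 t 1) with hτ₀
  have hτ₀' : τ₀ = 1 ∨ τ₀ = -1 := (xPrmWw n ℓ h R' q N Wm Wp).steer_eq_or k _
  have hστ : σB * τ₀ = 1 ∨ σB * τ₀ = -1 := by rcases hσB with rfl | rfl <;> rcases hτ₀' with h1 | h1 <;> simp [h1]
  have hσσ : σB * σB = 1 := by rcases hσB with h1 | h1 <;> simp [h1]
  have ht' := (mem_runSched_enl_iff 0 hσB 0 (xPrmWw_ok n ℓ h R' q N hWm hWp) (xPrmWw_eb n ℓ h R' q N Wm Wp)).1 ht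
  simp only [Pi.zero_apply, sub_zero, oth_zero'] at ht'
  obtain ⟨h0, hpc⟩ := landing_runX_W_signed (φ := φ) hn c₀ h hσB hστ hw R' (n * ℓ / shearUnit n h + 1) q N
  have e : σB * (σB * τ₀) = τ₀ := by rw [← mul_assoc, hσσ, one_mul]
  rw [e] at hpc
  have hpiece : (xPrmWw n ℓ h R' q N Wm Wp).InPiece τ₀ (σB * runX φ c₀ n h 1 w 1 - σB * runX φ c₀ n h 1 t 1 - (xPrmWw n ℓ h R' q N Wm Wp).d) := by
    have hd : (xPrmWw n ℓ h R' q N Wm Wp).d = 0 := rfl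
    rw [hd, sub_zero, ← mul_sub]
    exact hpc
  rw [RunPrm.scheduleN_core, RunPrm.mem_pcore_iff hσB]
  simp only [Pi.zero_apply, sub_zero, oth_zero']
  refine RunPrm.inCore_succ_of_landing (xPrmWw_ok n ℓ h R' q N hWm hWp) ht' ?_ ?_ hpiece
  · show ((xPrmWw n ℓ h R' q N Wm Wp).sLo : ℤ) ≤ σB * runX φ c₀ n h 1 w 0 - σB * runX φ c₀ n h 1 t 0
    rw [← mul_sub, h0]; exact le_rfl
  · show σB * runX φ c₀ n h 1 w 0 - σB * runX φ c₀ n h 1 t 0 ≤ (xPrmWw n ℓ h R' q N Wm Wp).sHi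
    rw [← mul_sub, h0]; exact le_rfl

end XBandW

/-! ## §3 The windowed y′-band in the run frame of sign `1` (along axis `1 = ⌊β′/U⌋`) -/

section YBandW

variable {n ℓ : ℕ} {h v : ℤ} (hn : 1 ≤ n) (hv : |v| ≤ n) (hlay : 2 * ((n + h.natAbs : ℕ) : ℤ) ≤ (n : ℤ) * ℓ + 1) (c₀ : V)
  {σB : ℤ} (hσB : σB = 1 ∨ σB = -1) (R' q N : ℕ) {Wm Wp : ℕ} (hWm : (n + v).toNat ≤ Wm) (hWp : (n - v).toNat ≤ Wp)
include hn

/-- **Link ⊆ region, signed y′-band with a free window**: `runX t` in the `R′`-enlarged core `k` of `(yPrmX …).scheduleN 1 σB 0` and `w ∈ pgramPrism t n h (3ℓ) R` give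
`runX w ∈ region k`. [cite: KozmaNitzan2024, §4 Lemma 11 (p. 22)] -/
theorem runX_mem_ybandWRegion_of_link {k : ℕ} {t w : V} {R : ℕ}
    (ht : runX φ c₀ n h 1 t ∈ Finset.Icc (((yPrmXw n ℓ h v R' q N Wm Wp).scheduleN 1 hσB 0 (yPrmXw_ok hn hv hlay R' q N hWm hWp) (yPrmXw_eb n ℓ h v R' q N Wm Wp)).lo k -
        ((((yPrmXw n ℓ h v R' q N Wm Wp).scheduleN 1 hσB 0 (yPrmXw_ok hn hv hlay R' q N hWm hWp) (yPrmXw_eb n ℓ h v R' q N Wm Wp)).R' : ℕ) : Site 2))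
      (((yPrmXw n ℓ h v R' q N Wm Wp).scheduleN 1 hσB 0 (yPrmXw_ok hn hv hlay R' q N hWm hWp) (yPrmXw_eb n ℓ h v R' q N Wm Wp)).hi k +
        ((((yPrmXw n ℓ h v R' q N Wm Wp).scheduleN 1 hσB 0 (yPrmXw_ok hn hv hlay R' q N hWm hWp) (yPrmXw_eb n ℓ h v R' q N Wm Wp)).R' : ℕ) : Site 2)))
    (hw : w ∈ pgramPrism G φ t n h (3 * ℓ) R) :
    runX φ c₀ n h 1 w ∈ ((yPrmXw n ℓ h v R' q N Wm Wp).scheduleN 1 hσB 0 (yPrmXw_ok hn hv hlay R' q N hWm hWp) (yPrmXw_eb n ℓ h v R' q N Wm Wp)).region k := by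
  have ht' := (mem_runSched_enl_iff 1 hσB 0 (yPrmXw_ok hn hv hlay R' q N hWm hWp) (yPrmXw_eb n ℓ h v R' q N Wm Wp)).1 ht
  -- the link readings of `link_runX` (x-record's numbers `La = n`, `Lb = 3nℓ/U + 1`) are the y-record's `Lb`, `La`
  obtain ⟨h0, h1⟩ := link_runX hn c₀ h (Or.inl rfl) hw R' q N
  have hσ1 : |σB| = 1 := by rcases hσB with rfl | rfl <;> simp
  rw [RunPrm.scheduleN_region, RunPrm.mem_pregion_iff hσB]
  simp only [Pi.zero_apply, sub_zero, oth_one'] at ht' ⊢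
  refine RunPrm.inRegion_of_link ht' ?_ ?_
  · rw [← mul_sub, abs_mul, hσ1, one_mul]; exact h1
  · rw [← mul_sub, abs_mul, hσ1, one_mul]; exact h0

/-- **Steered top piece ⊆ next core, signed y′-band with a free window**: every stride has physical sign `σB`; with `τₖ := steer k (σB·runX t 0)` (the drifted window's
steering sign at the seed's exact `α`), every `w ∈ pgTopPieceW t n h ℓ R σB τₖ v` has `runX w ∈ core (k+1)`.
[cite: MartineauTassion2017, §4.3 Lemma 4.2] [cite: KozmaNitzan2024, §4 Lemma 12 (pp. 23–25)] -/
theorem runX_mem_ybandWCore_succ_of_piece [G.LocallyFinite] {k : ℕ} {t w : V} {R : ℕ}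
    (ht : runX φ c₀ n h 1 t ∈ Finset.Icc (((yPrmXw n ℓ h v R' q N Wm Wp).scheduleN 1 hσB 0 (yPrmXw_ok hn hv hlay R' q N hWm hWp) (yPrmXw_eb n ℓ h v R' q N Wm Wp)).lo k -
        ((((yPrmXw n ℓ h v R' q N Wm Wp).scheduleN 1 hσB 0 (yPrmXw_ok hn hv hlay R' q N hWm hWp) (yPrmXw_eb n ℓ h v R' q N Wm Wp)).R' : ℕ) : Site 2))
      (((yPrmXw n ℓ h v R' q N Wm Wp).scheduleN 1 hσB 0 (yPrmXw_ok hn hv hlay R' q N hWm hWp) (yPrmXw_eb n ℓ h v R' q N Wm Wp)).hi k +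
        ((((yPrmXw n ℓ h v R' q N Wm Wp).scheduleN 1 hσB 0 (yPrmXw_ok hn hv hlay R' q N hWm hWp) (yPrmXw_eb n ℓ h v R' q N Wm Wp)).R' : ℕ) : Site 2)))
    (hw : w ∈ pgTopPieceW G φ t n h ℓ R σB ((yPrmXw n ℓ h v R' q N Wm Wp).steer k (σB * runX φ c₀ n h 1 t 0)) v) :
    runX φ c₀ n h 1 w ∈ ((yPrmXw n ℓ h v R' q N Wm Wp).scheduleN 1 hσB 0 (yPrmXw_ok hn hv hlay R' q N hWm hWp) (yPrmXw_eb n ℓ h v R' q N Wm Wp)).core (k + 1) := by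
  set τ₀ := (yPrmXw n ℓ h v R' q N Wm Wp).steer k (σB * runX φ c₀ n h 1 t 0) with hτ₀
  have hτ₀' : τ₀ = 1 ∨ τ₀ = -1 := (yPrmXw n ℓ h v R' q N Wm Wp).steer_eq_or k _
  have hc : (0 : ℤ) < (shearUnit n h : ℕ) := shearUnit_pos hn h
  have hc' : 0 < (shearUnit n h : ℤ) := shearUnit_pos hn h
  have ht' := (mem_runSched_enl_iff 1 hσB 0 (yPrmXw_ok hn hv hlay R' q N hWm hWp) (yPrmXw_eb n ℓ h v R' q N Wm Wp)).1 ht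
  simp only [Pi.zero_apply, sub_zero, oth_one'] at ht'
  obtain ⟨hb1, hb2, -, hp1, hm1⟩ := topPieceW_run_bounds hσB hw
  -- along: the floored `β′` reading, both signs
  have hsLo : (yPrmXw n ℓ h v R' q N Wm Wp).sLo = ((n : ℤ) * ℓ - (shearUnit n h : ℕ) + 1) / (shearUnit n h : ℕ) - 1 := rfl
  have hsHi : (yPrmXw n ℓ h v R' q N Wm Wp).sHi = (n : ℤ) * ℓ / (shearUnit n h : ℕ) + 1 := rfl
  have halong : (yPrmXw n ℓ h v R' q N Wm Wp).sLo ≤ σB * (runX φ c₀ n h 1 w 1 - runX φ c₀ n h 1 t 1) ∧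
      σB * (runX φ c₀ n h 1 w 1 - runX φ c₀ n h 1 t 1) ≤ (yPrmXw n ℓ h v R' q N Wm Wp).sHi := by
    rw [hsLo, hsHi]
    have hU : ((shearUnit n h : ℕ) : ℤ) = ((n + h.natAbs : ℕ) : ℤ) := rfl
    rw [hU]
    rcases hσB with hs | hs <;> rw [hs] at hb1 hb2 ⊢
    · rw [one_mul] at hb1 hb2
      obtain ⟨hl, hu⟩ := runX_sub_runX_one_bounds hn φ c₀ h 1 t w (a := (n : ℤ) * ℓ - (n + h.natAbs : ℕ) + 1) (b := (n : ℤ) * ℓ)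
        (by rw [one_mul]; exact hb1) (by rw [one_mul]; exact hb2)
      rw [hU] at hl hu
      constructor <;> linarith
    · have hb1' : -((n : ℤ) * ℓ) ≤ 1 * shearCoord φ t n h w := by linarith
      have hb2' : 1 * shearCoord φ t n h w ≤ -((n : ℤ) * ℓ - (n + h.natAbs : ℕ) + 1) := by linarith
      obtain ⟨hl, hu⟩ := runX_sub_runX_one_bounds hn φ c₀ h 1 t w hb1' hb2'
      have hnb := neg_ediv_neg_bounds ((n : ℤ) * ℓ) hc'
      have hna := neg_ediv_neg_bounds ((n : ℤ) * ℓ - (n + h.natAbs : ℕ) + 1) hc'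
      rw [hU] at hl hu hnb hna
      constructor <;> linarith
  -- transverse: `σB·Δα − v` in the exact piece of sign `τ₀`
  have h0 : runX φ c₀ n h 1 w 0 - runX φ c₀ n h 1 t 0 = relCoord φ t 0 w := by rw [runX_sub_runX_zero, one_mul]
  have hpiece : (yPrmXw n ℓ h v R' q N Wm Wp).InPiece τ₀ (σB * runX φ c₀ n h 1 w 0 - σB * runX φ c₀ n h 1 t 0 - (yPrmXw n ℓ h v R' q N Wm Wp).d) := by
    have hd : (yPrmXw n ℓ h v R' q N Wm Wp).d = v := rfl
    have hPp : ((yPrmXw n ℓ h v R' q N Wm Wp).Pp : ℤ) = n - v := by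
      show (((n - v).toNat : ℕ) : ℤ) = n - v; rw [Int.toNat_of_nonneg (by linarith [(abs_le.1 hv).2])]
    have hPm : ((yPrmXw n ℓ h v R' q N Wm Wp).Pm : ℤ) = n + v := by
      show (((n + v).toNat : ℕ) : ℤ) = n + v; rw [Int.toNat_of_nonneg (by linarith [(abs_le.1 hv).1])]
    rw [hd, ← mul_sub, h0, ChainPara.RunPrm.InPiece, hPp, hPm]
    have hαn : |relCoord φ t 0 w| ≤ n := ((mem_pgramCyl (φ := φ)).1 ((mem_pgTopPieceW G φ).1 hw).2.1).1
    have hσα : σB * relCoord φ t 0 w ≤ n := by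
      rcases hσB with hs | hs <;> rw [hs] <;> [linarith [(abs_le.1 hαn).2]; linarith [(abs_le.1 hαn).1]]
    have hσα' : -(n : ℤ) ≤ σB * relCoord φ t 0 w := by
      rcases hσB with hs | hs <;> rw [hs] <;> [linarith [(abs_le.1 hαn).1]; linarith [(abs_le.1 hαn).2]]
    constructor
    · intro h1; have := hp1 h1; constructor <;> linarith
    · intro h1; have := hm1 h1; constructor <;> linarith
  rw [RunPrm.scheduleN_core, RunPrm.mem_pcore_iff hσB]
  simp only [Pi.zero_apply, sub_zero, oth_one']
  refine RunPrm.inCore_succ_of_landing (yPrmXw_ok hn hv hlay R' q N hWm hWp) ht' ?_ ?_ hpiece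
  · rw [← mul_sub]; exact halong.1
  · rw [← mul_sub]; exact halong.2

end YBandW

end Skelφ

end Summit.CriticalPhenomena.PercolationContinuityZ3.Theorems.Transplant

end
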